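import Literature.NumberTheory.FaltingsSerre.GSp4F2Hom
import Literature.NumberTheory.GaloisRepresentations.ResidualGaloisRep
import Literature.RepresentationTheory.Semisimple.BurnsideMatrixSpan
import HarnessLib

/-!
# The Faltings–Serre method after Brumer–Pacetti–Poor–Tornaría–Voight–Yuen, VIII:
# the residual images `S₅(b)`, `S₆`, `S₃ ≀ S₂ ≤ GSp₄(𝔽₂)` are ABSOLUTELY IRREDUCIBLE — kernel-checked

[BPPTVY] = A. Brumer, A. Pacetti, C. Poor, G. Tornaría, J. Voight, D. S. Yuen, *On the paramodularity of
typical abelian surfaces*, Algebra & Number Theory **13**:5 (2019) 1145–1195 [cite: BrumerEtAl2019].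
PRINTED numbering (= arXiv:1805.10873v4 Lemma 43, Example 44, Lemma 46):

* **Lemma 5.1.7** (p. 1174). "There are, up to inner automorphism, exactly `9` subgroups of
  `Sp₄(𝔽₂) ≅ S₆` with absolutely irreducible image" — table: `S₆` (720), `A₆` (360), `S₅(a)`,
  `S₅(b)` (120), `S₃ ≀ S₂` (72), `A₅(b)` (60), `C₃² ⋊ C₄` (36), `S₃(a)²` (36), `C₅ ⋊ C₄` (20).
* **Example 5.1.9** (p. 1174): `S₅(b) → GSp₄(𝔽₂)` is generated by the images of `(1 2 3 4 5)`, `(1 2)`,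
  `(1 2 3)` (matrices (5.1.10); `GSp4F2.iota_S5b_generators`).
* **Lemma 5.2.1** (p. 1174). For `N` odd squarefree and `A/ℚ` of conductor `N` with a polarization
  of odd degree, `ρ̄_{A,2}` "is absolutely irreducible if and only if its image is isomorphic to
  `S₅(b)`, `S₆`, or `S₃ ≀ S₂`."

The hypothesis "`ρ̄` absolutely irreducible" of the Faltings–Serre criterion [BPPTVY, Thm 2.1.5] is
the field `Certificate.absIrreducible : IsAbsIrreducible (residual ρ₁)` of the tree's certificate
schema (`FaltingsSerre/ParamodularCertificate.lean`).  THIS FILE turns the three rows of Lemma 5.1.7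
that Lemma 5.2.1 singles out into KERNEL THEOREMS, in the form the certificate pipeline consumes:

* `GSp4F2.span_iota_S5b_eq_top`, `…_S6_…`, `…_S3wrS2_…` — the `𝔽₂`-span of `ι(H)` is ALL of
  `M₄(𝔽₂)` for `H = S₅(b) = ⟨(12345),(12),(123)⟩`, `S₆ = ⟨(12345),(16)⟩`,
  `S₃ ≀ S₂ = ⟨(123),(12),(14)(25)(36)⟩` (explicit certificates `certS5b` … : each elementary matrix
  `E_{ij}` is a sum of at most four `ι(w)`, `w` a word in the generators; `decide +kernel`);
* by Burnside's criterion in the tree's form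
  (`Literature.RepresentationTheory.Semisimple.span_eq_top_iff_forall_isIrreducible`: for `n ≥ 1`,
  `k⟨φ(G)⟩ = M_n(k)` iff `φ` is irreducible after every extension of scalars, i.e. the tree's
  `IsAbsIrreducible φ`), `GSp4F2.isAbsIrreducible_of_conj_gens_mem_range`: **a homomorphism
  `σ : Γ → GL₄(𝔽₂)` whose image contains a conjugate `g ι(H) g⁻¹` of one of these three groups —
  witnessed on the GENERATORS only — is absolutely irreducible**
  (`isAbsIrreducible_of_S5b`, `isAbsIrreducible_of_S6`, `isAbsIrreducible_of_S3wrS2`).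

So a certificate seat discharges `Certificate.absIrreducible` by exhibiting `g ∈ GL₄(𝔽₂)` and, for
each of the ≤ 3 generators `τ`, an element `γ ∈ Gal(ℚ̄/ℚ)` with `ρ̄_{A,2}(γ) = g ι(τ) g⁻¹` — data it
reads off the `2`-division field — instead of citing Lemma 5.1.7.  (`S₃ ≀ S₂ ≤ S₆`: the stabilizer of
the partition `{1,2,3} ⊔ {4,5,6}`, i.e. the normalizer of a Sylow `3`-subgroup, unique up to
conjugacy; the paper prints no generators for it, the three above are the typer's choice — cell
pub-paramod DIVERGENCE.md D-16.)  The other six rows of Lemma 5.1.7 and its exhaustiveness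
("exactly 9") are not needed by [BPPTVY, Lemma 5.2.1] and are not transcribed.

## References
* [BPPTVY] ANT 13:5 (2019): Lemma 5.1.7, Example 5.1.9 (5.1.10), Lemma 5.2.1, p. 1174. [cite: BrumerEtAl2019]
* W. Burnside, Proc. LMS 3 (1905) 430–434; Curtis–Reiner (1962) (27.4), (29.13) — via
  `Literature.RepresentationTheory.Semisimple.BurnsideMatrixSpan`.
-/

namespace Literature.NumberTheory.FaltingsSerre.GSp4F2

open Matrix Equiv Equiv.Perm Literature.NumberTheory.GaloisRepresentations

/-! ### A. Generators and word evaluation -/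

/-- `(1 4)(2 5)(3 6) ∈ S₆`, swapping the blocks `{1,2,3}` and `{4,5,6}` (typer's generator of
`S₃ ≀ S₂` together with `(1 2 3)`, `(1 2)`). [cite: BrumerEtAl2019, Lemma 5.1.7 p. 1174] -/
def bswap : Perm (Fin 6) := c[(0 : Fin 6), 3] * c[(1 : Fin 6), 4] * c[(2 : Fin 6), 5]

/-- Printed generators of `S₅(b) = Stab_{S₆}(6)`: `(1 2 3 4 5)`, `(1 2)`, `(1 2 3)` [BPPTVY, (5.1.10)]. [cite: BrumerEtAl2019, Example 5.1.9 p. 1174] -/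
def gensS5b : Fin 3 → Perm (Fin 6) := ![c12345, t12, c123]

/-- Printed generators of `S₆`: `(1 2 3 4 5)`, `(1 6)` [BPPTVY, (5.1.1)]. [cite: BrumerEtAl2019, (5.1.1) p. 1173] -/
def gensS6 : Fin 2 → Perm (Fin 6) := ![c12345, t16]

/-- Generators of `S₃ ≀ S₂ ≤ S₆` (stabilizer of `{1,2,3} ⊔ {4,5,6}`): `(1 2 3)`, `(1 2)`,
`(1 4)(2 5)(3 6)` (typer's choice). [cite: BrumerEtAl2019, Lemma 5.1.7 p. 1174] -/
def gensS3wrS2 : Fin 3 → Perm (Fin 6) := ![c123, t12, bswap]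

/-- The element of `S₆` denoted by a word in generators `G` (product, left to right). [folklore] -/
def evalWord {m : ℕ} (G : Fin m → Perm (Fin 6)) (w : List (Fin m)) : Perm (Fin 6) :=
  (w.map G).prod

/-- A word in the generators lies in the subgroup they generate. [folklore] -/
theorem evalWord_mem {m : ℕ} (G : Fin m → Perm (Fin 6)) (w : List (Fin m)) :
    evalWord G w ∈ Subgroup.closure (Set.range G) := by
  refine Subgroup.list_prod_mem _ fun x hx => ?_
  rw [List.mem_map] at hx
  obtain ⟨i, -, rfl⟩ := hx
  exact Subgroup.subset_closure ⟨i, rfl⟩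

/-- The sum of the `ι`-images of a list of words. [folklore] -/
def iotaWordSum {m : ℕ} (G : Fin m → Perm (Fin 6)) (ws : List (List (Fin m))) :
    Matrix (Fin 4) (Fin 4) (ZMod 2) :=
  (ws.map fun w => iota (evalWord G w)).sum

/-- Such a sum lies in the span of `ι(⟨G⟩)`. [folklore] -/
theorem iotaWordSum_mem_span {m : ℕ} (G : Fin m → Perm (Fin 6)) (ws : List (List (Fin m))) :
    iotaWordSum G ws ∈
      Submodule.span (ZMod 2) (iota '' (Subgroup.closure (Set.range G) : Set (Perm (Fin 6)))) := by
  refine list_sum_mem fun x hx => ?_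
  rw [List.mem_map] at hx
  obtain ⟨w, -, rfl⟩ := hx
  exact Submodule.subset_span ⟨evalWord G w, evalWord_mem G w, rfl⟩

/-- SPANNING FROM A CERTIFICATE: if every elementary matrix `E_{ij}` is an `iotaWordSum` over words
in `G`, then `𝔽₂⟨ι(⟨G⟩)⟩ = M₄(𝔽₂)`. [folklore] -/
theorem span_iota_eq_top_of_cert {m : ℕ} (G : Fin m → Perm (Fin 6))
    (cert : Fin 4 → Fin 4 → List (List (Fin m)))
    (hcert : ∀ i j : Fin 4, iotaWordSum G (cert i j) = Matrix.single i j 1) :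
    Submodule.span (ZMod 2) (iota '' (Subgroup.closure (Set.range G) : Set (Perm (Fin 6)))) = ⊤ := by
  refine Submodule.eq_top_iff'.mpr fun M => ?_
  rw [Matrix.matrix_eq_sum_single M]
  refine Submodule.sum_mem _ fun i _ => Submodule.sum_mem _ fun j _ => ?_
  have h1 : Matrix.single i j (M i j) = M i j • Matrix.single i j (1 : ZMod 2) := by
    ext a b
    by_cases h : i = a ∧ j = b <;> simp [Matrix.single, h]
  rw [h1, ← hcert i j]
  exact Submodule.smul_mem _ _ (iotaWordSum_mem_span G (cert i j))

/-! ### B. The three certificates (Lemma 5.1.7, rows `S₅(b)`, `S₆`, `S₃ ≀ S₂`) -/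

/-- Certificate for `S₅(b)`: `E_{ij}` as a sum of `ι`-images of words in `(12345),(12),(123)`. [cite: BrumerEtAl2019, Lemma 5.1.7 p. 1174] -/
def certS5b : Fin 4 → Fin 4 → List (List (Fin 3)) :=
  ![![[[2], [0, 0], [1, 2], [1, 0, 0]], [[0, 0], [1, 0, 0]], [[2], [1, 2], [0, 1, 0], [2, 0, 0]], [[], [1]]],
    ![[[1], [0, 2, 0, 2], [0, 0, 0, 1, 0], [0, 2, 2, 0, 2]], [[0, 0, 0, 0], [0, 0, 1, 0, 0]], [[0, 1, 0, 0, 2], [0, 2, 0, 0, 0]], [[0, 0], [0, 0, 1]]],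
    ![[[0], [2], [0, 0, 2, 0], [1, 0, 0, 1]], [[], [0, 0], [2, 0, 2], [0, 2, 1, 0]], [[0], [2], [1, 0, 0], [0, 0, 2, 2, 0]], [[0, 0, 0], [0, 0, 0, 1]]],
    ![[[], [0, 1], [0, 2, 0], [0, 1, 0, 2, 0]], [[0], [2], [0, 2, 0, 0], [0, 2, 0, 2]], [[0, 0], [2, 0], [0, 1, 0, 0, 1], [0, 2, 0, 0, 0]], [[1, 0], [2, 0], [0, 0, 0], [0, 0, 0, 1]]]]

/-- Certificate for `S₆`: words in `(12345),(16)`. [cite: BrumerEtAl2019, Lemma 5.1.7 p. 1174] -/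
def certS6 : Fin 4 → Fin 4 → List (List (Fin 2)) :=
  ![![[[0], [0, 0, 1, 0, 1], [0, 1, 0, 0, 0]], [[0, 0], [0, 0, 0], [0, 1, 0, 0], [1, 0, 1, 0]], [[0, 0, 0], [0, 0, 0, 0], [0, 1, 0, 0, 0], [1, 0, 1, 0, 0]], [[0, 1], [0, 0, 1, 0], [0, 1, 0, 0, 0, 1]]],
    ![[[0, 1, 0, 1], [1, 0, 0, 0], [0, 1, 0, 0, 0, 0]], [[], [0, 0, 0, 0], [0, 0, 0, 1, 0, 0], [0, 0, 1, 0, 1, 0]], [[], [0, 0, 1, 0, 0], [0, 1, 0, 1, 0], [1, 0, 1, 0, 1]], [[0, 1], [1, 0, 0, 0], [0, 1, 0, 0, 0], [0, 1, 0, 0, 1]]],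
    ![[[0, 0, 1, 0, 1], [0, 1, 0, 0, 0], [0, 0, 1, 0, 0, 0, 0]], [[1], [1, 0, 1, 0], [0, 1, 0, 0, 1, 0]], [[0], [0, 0, 0, 1, 0, 0], [0, 0, 1, 0, 1, 0], [0, 1, 0, 1, 0, 1]], [[0, 0, 1], [0, 1, 0, 0, 0], [0, 0, 1, 0, 0, 0], [0, 0, 1, 0, 0, 1]]],
    ![[[], [0, 1, 0, 0, 0, 0]], [[0, 0], [0, 0, 0], [0, 1, 0], [0, 1, 0, 0]], [[0, 0, 0], [0, 0, 0, 0], [0, 1, 0, 0], [0, 1, 0, 0, 0]], [[0, 0, 0, 0], [0, 0, 1, 0], [0, 1, 0, 0, 0], [0, 1, 0, 1, 0]]]]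

/-- Certificate for `S₃ ≀ S₂`: words in `(123),(12),(14)(25)(36)`. [cite: BrumerEtAl2019, Lemma 5.1.7 p. 1174] -/
def certS3wrS2 : Fin 4 → Fin 4 → List (List (Fin 3)) :=
  ![![[[0], [2], [1, 0], [1, 2]], [[2], [1, 2]], [[], [1], [0, 0, 2], [0, 1, 2]], [[], [1]]],
    ![[[2, 1], [1, 2, 0, 0], [0, 2, 0, 1, 2], [1, 0, 2, 0, 2]], [[2], [1, 2], [2, 0, 2], [2, 0, 1, 2]], [[], [0, 0, 2, 0], [0, 1, 2, 0, 1], [1, 2, 1, 0, 2]], [[], [1], [2, 0], [2, 0, 1]]],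
    ![[[], [2, 0], [2, 1, 0], [2, 1, 2]], [[], [2, 1, 2]], [[2], [2, 1], [2, 0, 0, 2], [2, 0, 1, 2]], [[2], [2, 1]]],
    ![[[], [0, 0, 2, 0], [0, 1, 2, 1, 2], [1, 0, 2, 1, 0]], [[], [0, 0, 2], [1, 0, 2], [2, 1, 2]], [[0, 2], [1, 2, 1], [0, 0, 2, 0, 0, 2], [1, 0, 2, 0, 1, 2]], [[2], [0, 0], [1, 0], [2, 1]]]]

/-- KERNEL CHECK of the `S₅(b)` certificate. [cite: BrumerEtAl2019, Lemma 5.1.7 p. 1174] -/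
theorem certS5b_spec : ∀ i j : Fin 4, iotaWordSum gensS5b (certS5b i j) = Matrix.single i j 1 := by
  unfold iotaWordSum gensS5b certS5b evalWord iota projZ basisZ permAction c12345 t12 c123
  decide +kernel

/-- KERNEL CHECK of the `S₆` certificate. [cite: BrumerEtAl2019, Lemma 5.1.7 p. 1174] -/
theorem certS6_spec : ∀ i j : Fin 4, iotaWordSum gensS6 (certS6 i j) = Matrix.single i j 1 := by
  unfold iotaWordSum gensS6 certS6 evalWord iota projZ basisZ permAction c12345 t16
  decide +kernel

/-- KERNEL CHECK of the `S₃ ≀ S₂` certificate. [cite: BrumerEtAl2019, Lemma 5.1.7 p. 1174] -/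
theorem certS3wrS2_spec :
    ∀ i j : Fin 4, iotaWordSum gensS3wrS2 (certS3wrS2 i j) = Matrix.single i j 1 := by
  unfold iotaWordSum gensS3wrS2 certS3wrS2 evalWord iota projZ basisZ permAction c123 t12 bswap
  decide +kernel

/-- **Lemma 5.1.7, row `S₅(b)`**: `𝔽₂⟨ι(S₅(b))⟩ = M₄(𝔽₂)` (`S₅(b) = ⟨(12345),(12),(123)⟩`). [cite: BrumerEtAl2019, Lemma 5.1.7 p. 1174] -/
theorem span_iota_S5b_eq_top :
    Submodule.span (ZMod 2) (iota '' (Subgroup.closure (Set.range gensS5b) : Set (Perm (Fin 6)))) = ⊤ :=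
  span_iota_eq_top_of_cert gensS5b certS5b certS5b_spec

/-- **Lemma 5.1.7, row `S₆`**: `𝔽₂⟨ι(S₆)⟩ = M₄(𝔽₂)` (`S₆ = ⟨(12345),(16)⟩`). [cite: BrumerEtAl2019, Lemma 5.1.7 p. 1174] -/
theorem span_iota_S6_eq_top :
    Submodule.span (ZMod 2) (iota '' (Subgroup.closure (Set.range gensS6) : Set (Perm (Fin 6)))) = ⊤ :=
  span_iota_eq_top_of_cert gensS6 certS6 certS6_spec

/-- **Lemma 5.1.7, row `S₃ ≀ S₂`**: `𝔽₂⟨ι(S₃ ≀ S₂)⟩ = M₄(𝔽₂)` (`S₃ ≀ S₂ = ⟨(123),(12),(14)(25)(36)⟩`). [cite: BrumerEtAl2019, Lemma 5.1.7 p. 1174] -/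
theorem span_iota_S3wrS2_eq_top :
    Submodule.span (ZMod 2) (iota '' (Subgroup.closure (Set.range gensS3wrS2) : Set (Perm (Fin 6)))) = ⊤ :=
  span_iota_eq_top_of_cert gensS3wrS2 certS3wrS2 certS3wrS2_spec

/-! ### C. Absolute irreducibility of homomorphisms whose image contains a conjugate -/

/-- **Transfer to an arbitrary `σ : Γ → GL₄(𝔽₂)`.**  If `𝔽₂⟨ι(⟨G⟩)⟩ = M₄(𝔽₂)` and the image of `σ`
contains `g ι(Gᵢ) g⁻¹` for every generator `Gᵢ`, then `σ` is absolutely irreducible (tree notion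
`IsAbsIrreducible`: irreducible after every extension of scalars): the image then contains
`g ι(⟨G⟩) g⁻¹`, whose span is `g M₄(𝔽₂) g⁻¹ = M₄(𝔽₂)`, and Burnside's criterion
(`span_eq_top_iff_forall_isIrreducible`) applies. [cite: BrumerEtAl2019, Lemma 5.1.7 p. 1174] -/
theorem isAbsIrreducible_of_conj_gens_mem_range {Γ : Type*} [Group Γ]
    (σ : Γ →* GL (Fin 4) (ZMod 2)) {m : ℕ} (G : Fin m → Perm (Fin 6))
    (hspan : Submodule.span (ZMod 2)
      (iota '' (Subgroup.closure (Set.range G) : Set (Perm (Fin 6)))) = ⊤)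
    (g : GL (Fin 4) (ZMod 2)) (h : ∀ i, g * iotaGL (G i) * g⁻¹ ∈ σ.range) :
    IsAbsIrreducible σ := by
  -- the whole subgroup `⟨G⟩` conjugates into the image
  have hcl : ∀ τ ∈ Subgroup.closure (Set.range G), g * iotaGL τ * g⁻¹ ∈ σ.range := by
    intro τ hτ
    have hle : Subgroup.closure (Set.range G) ≤
        σ.range.comap ((MulAut.conj g).toMonoidHom.comp iotaGL) := by
      rw [Subgroup.closure_le]
      rintro _ ⟨i, rfl⟩
      simpa using h i
    simpa using hle hτ
  -- hence the matrices of the image span `M₄(𝔽₂)`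
  set W : Submodule (ZMod 2) (Matrix (Fin 4) (Fin 4) (ZMod 2)) := Submodule.span (ZMod 2)
    (Set.range fun γ => ((σ γ : GL (Fin 4) (ZMod 2)) : Matrix (Fin 4) (Fin 4) (ZMod 2))) with hW
  have key : ∀ N ∈ Submodule.span (ZMod 2)
      (iota '' (Subgroup.closure (Set.range G) : Set (Perm (Fin 6)))),
      (g : Matrix (Fin 4) (Fin 4) (ZMod 2)) * N * ((g⁻¹ : GL (Fin 4) (ZMod 2)) : Matrix _ _ _) ∈ W := by
    intro N hN
    induction hN using Submodule.span_induction with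
    | mem x hx =>
      obtain ⟨τ, hτ, rfl⟩ := hx
      obtain ⟨γ, hγ⟩ := hcl τ hτ
      refine Submodule.subset_span ⟨γ, ?_⟩
      have hγ' := congrArg (fun u : GL (Fin 4) (ZMod 2) => (u : Matrix (Fin 4) (Fin 4) (ZMod 2))) hγ
      simpa [Units.val_mul] using hγ'
    | zero => simp
    | add x y _ _ hx hy =>
      rw [Matrix.mul_add, Matrix.add_mul]
      exact W.add_mem hx hy
    | smul c x _ hx =>
      rw [Matrix.mul_smul, Matrix.smul_mul]
      exact W.smul_mem c hx
  have hspan' : W = ⊤ := by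
    refine Submodule.eq_top_iff'.mpr fun M => ?_
    have hM : ((g⁻¹ : GL (Fin 4) (ZMod 2)) : Matrix _ _ _) * M * (g : Matrix (Fin 4) (Fin 4) (ZMod 2)) ∈
        Submodule.span (ZMod 2) (iota '' (Subgroup.closure (Set.range G) : Set (Perm (Fin 6)))) := by
      rw [hspan]; exact Submodule.mem_top
    have hk := key _ hM
    have hcalc : (g : Matrix (Fin 4) (Fin 4) (ZMod 2)) *
        (((g⁻¹ : GL (Fin 4) (ZMod 2)) : Matrix _ _ _) * M * (g : Matrix (Fin 4) (Fin 4) (ZMod 2))) *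
        ((g⁻¹ : GL (Fin 4) (ZMod 2)) : Matrix _ _ _) = M := by
      rw [← Matrix.mul_assoc, ← Matrix.mul_assoc, Units.mul_inv, Matrix.one_mul, Matrix.mul_assoc,
        Units.mul_inv, Matrix.mul_one]
    rwa [hcalc] at hk
  -- Burnside's criterion
  intro L _ f
  exact (Literature.RepresentationTheory.Semisimple.span_eq_top_iff_forall_isIrreducible
    (by norm_num) σ).1 (hW ▸ hspan') L f

/-- **Image containing a conjugate of `S₅(b)` ⇒ absolutely irreducible** — witnessed on the printed
generators `(12345)`, `(12)`, `(123)` [BPPTVY, (5.1.10)]. [cite: BrumerEtAl2019, Lemma 5.1.7 + Lemma 5.2.1 p. 1174] -/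
theorem isAbsIrreducible_of_S5b {Γ : Type*} [Group Γ] (σ : Γ →* GL (Fin 4) (ZMod 2))
    (g : GL (Fin 4) (ZMod 2)) (h₁ : g * iotaGL c12345 * g⁻¹ ∈ σ.range)
    (h₂ : g * iotaGL t12 * g⁻¹ ∈ σ.range) (h₃ : g * iotaGL c123 * g⁻¹ ∈ σ.range) :
    IsAbsIrreducible σ :=
  isAbsIrreducible_of_conj_gens_mem_range σ gensS5b span_iota_S5b_eq_top g fun i => by
    fin_cases i
    exacts [h₁, h₂, h₃]

/-- **Image containing a conjugate of `S₆` ⇒ absolutely irreducible** — generators `(12345)`, `(16)`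
[BPPTVY, (5.1.1)]. [cite: BrumerEtAl2019, Lemma 5.1.7 + Lemma 5.2.1 p. 1174] -/
theorem isAbsIrreducible_of_S6 {Γ : Type*} [Group Γ] (σ : Γ →* GL (Fin 4) (ZMod 2))
    (g : GL (Fin 4) (ZMod 2)) (h₁ : g * iotaGL c12345 * g⁻¹ ∈ σ.range)
    (h₂ : g * iotaGL t16 * g⁻¹ ∈ σ.range) : IsAbsIrreducible σ :=
  isAbsIrreducible_of_conj_gens_mem_range σ gensS6 span_iota_S6_eq_top g fun i => by
    fin_cases i
    exacts [h₁, h₂]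

/-- **Image containing a conjugate of `S₃ ≀ S₂` ⇒ absolutely irreducible** — generators `(123)`,
`(12)`, `(14)(25)(36)`. [cite: BrumerEtAl2019, Lemma 5.1.7 + Lemma 5.2.1 p. 1174] -/
theorem isAbsIrreducible_of_S3wrS2 {Γ : Type*} [Group Γ] (σ : Γ →* GL (Fin 4) (ZMod 2))
    (g : GL (Fin 4) (ZMod 2)) (h₁ : g * iotaGL c123 * g⁻¹ ∈ σ.range)
    (h₂ : g * iotaGL t12 * g⁻¹ ∈ σ.range) (h₃ : g * iotaGL bswap * g⁻¹ ∈ σ.range) :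
    IsAbsIrreducible σ :=
  isAbsIrreducible_of_conj_gens_mem_range σ gensS3wrS2 span_iota_S3wrS2_eq_top g fun i => by
    fin_cases i
    exacts [h₁, h₂, h₃]

/-- In particular `ι` itself, restricted to any subgroup containing `S₅(b)`, e.g. on all of `S₆`, is
absolutely irreducible: the `4`-dimensional representation `Z = U⁰/L` of `S₆` over `𝔽₂`. [cite: BrumerEtAl2019, Lemma 5.1.7 p. 1174] -/
theorem isAbsIrreducible_iotaGL : IsAbsIrreducible iotaGL :=
  isAbsIrreducible_of_S6 iotaGL 1 (by simp) (by simp)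

end Literature.NumberTheory.FaltingsSerre.GSp4F2
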